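import Mathlib
import Literature.Analysis.FluidPDE.HardSphereDynamics
import Literature.MathematicalPhysics.KineticTheory.HardBallErgodicity
import HarnessLib

/-!
# u-regular (u-Gibbs / SRB-type) states: absolutely continuous conditional measures on
# unstable plaques, for measurable flows and for the hard-ball flow

Topic `Literature/Dynamics/Billiards`; definition item `defn-URegularState` (request D2 of route
`Summits/AtomisticToContinuum/HydrodynamicLimit/Theses/UGibbsRigidity.lean`; consumers: the informal
cruxes URegularLimits (stmt-5478, clause (iv)), URigidity (stmt-5572, hypothesis) and the finite-`N`
sanity support FiniteNSanity (stmt-5712)).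

## Contents

1. **Conditional measures on a measurable partition** (Rokhlin; Ledrappier–Young 1985 (1.3)).
   A measurable partition of a standard Borel space is encoded by the σ-algebra of its measurable
   saturated sets, a *countably generated sub-σ-algebra* (`MeasurablePartition`, with `atom` the
   partition element through a point and `comap` the partition into fibres of a measurable map),
   and the canonical system of conditional measures `MeasurablePartition.condMeasure` is Mathlib's
   `ProbabilityTheory.condExpKernel μ ξ.sigma`. Proved here: the barycentre formula
   `bind_condExpKernel` / `bind_condMeasure` (`μ = ∫ μ_x^ξ μ(dx)`), properness
   `condExpKernel_apply_ae_eq_indicator` (`μ_x^ξ(B) = 1_B(x)` a.s. for saturated `B`) and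
   `ae_condMeasure_atom_eq_one` (a.e. conditional measure is carried by its partition element).
2. **Plaque families** `PlaqueFamily α` (a plaque `W(x) ⊆ α` and a leaf reference measure `m_x`
   attached to every point) and, for a law `μ`, the two renderings of "the conditional measures of
   `μ` on the plaques are absolutely continuous":
   * `PlaqueFamily.IsSubordinate` / `PlaqueFamily.HasACCondMeasures` — Ledrappier–Young's
     Definitions 1.4.1 / 1.4.2 verbatim: for every measurable partition subordinate to the
     plaques, `π^x ≪ m_x` for `μ`-a.e. `x`;
   * `PlaqueFamily.IsURegular` — the partition-free (transversal) form: `μ` charges no measurable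
     set that is `m_x`-null on `μ`-almost every plaque `W(x)`.
   `HasACCondMeasures.isURegular` proves LY ⇒ transversal as soon as one subordinate partition
   exists (the converse — Lebesgue-decompose the conditional measures and collect the singular
   parts — holds whenever the plaques are σ-compact and carry subordinate partitions, i.e.
   wherever the notion is used; it is not needed here and not claimed). The transversal form is
   the one that is manifestly **convex** (`IsURegular.add`, `IsURegular.smul`, `IsURegular.bind`:
   mixtures `∫ κ_i P(di)` of u-regular laws are u-regular; `convex_uRegularStates`) and
   **covariant** (`IsURegular.map_equiv`: push-forward by a symmetry mapping plaques to plaques and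
   leaf measures into leaf measures), the two structural properties the route asked for.
3. **Unstable sets of a measurable flow** `T : ℝ → α → α` on a metric space (no smoothness, no
   invariant-manifold theorem assumed): the global unstable set `unstableSet T z` (backward orbits
   converge exponentially: Ledrappier–Young (1.2), Barreira–Pesin (flows)), the local unstable set
   `localUnstableSet T δ z` (moreover `δ`-close for all backward times: the points making up the
   local unstable manifold `W^u_δ(z)`), the plaque family `unstablePlaques T δ k` with leaf measure
   the `k`-dimensional Hausdorff measure `μH[k]`, and the predicates `IsUGibbsOfDim T k μ`
   (LY form) and `IsURegularOfDim T k μ` (transversal form), quantified over all measurable size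
   functions `δ > 0`; equivariance under isometries commuting with the flow
   (`preimage_localUnstableSet_of_isometry`, `IsURegularOfDim.map_isometryEquiv`).
4. **Hard balls, finite `N`** (`Literature.Analysis.FluidPDE.HardSphereFlow`): dot-notation
   specialisations `Φ.unstableSet`, `Φ.localUnstableSet`, and on the torus `𝕋^d` the predicates
   `Φ.IsUGibbs μ`, `Φ.IsURegular μ` with the hard-ball unstable dimension
   `hardBallUnstableDim d N = dN - d - 1`; `uRegularStates` / `URegularState` (the convex set of
   u-regular probability laws of a plaque family).

## Design choices (and what is deliberately NOT here)

* *Leaf Lebesgue measure = Hausdorff measure.* On a `k`-dimensional `C¹` plaque of the phase space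
  `(𝕋^d × ℝ^d)^N` (sup-product metric, locally bi-Lipschitz to Euclidean `ℝ^{2dN}`) the Riemannian
  leaf volume and `μH[k]` are mutually absolutely continuous with locally bounded densities, so
  "`≪` leaf volume" is rendered as "`≪ μH[k]`"; only null sets matter. The unstable dimension `k`
  is an explicit parameter of the generic predicates (with the wrong `k` they are trivially false
  or vacuous, see `IsURegular` docstring); for `N` balls on `𝕋^d` it is `dN - d - 1`.
* *No measurability of plaques is needed or claimed*: `unstableSet` / `localUnstableSet` are
  defined by quantifying over all backward times; the predicates only evaluate (outer) measures
  `m_x (s ∩ W(x))` and inclusions `atom ⊆ W(x)`.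
* *Subordination uses the subspace topology*: LY 1.4.1 (2) asks the partition element to contain
  a neighbourhood of `x` open in the leaf topology of the immersed global leaf `W^u(x)`; for the
  LOCAL plaques used here (backward orbits `δ`-close for all times) the leaf topology is the
  subspace topology, so (2) reads `U ∩ W(x) ⊆ ξ(x)` for an ambient neighbourhood `U` of `x`.
* *Existence of local unstable manifolds* for hard balls (Sinai–Chernov 1987; Katok–Strelcyn
  1986 Part V; complete hyperbolicity Simányi–Szász 1999, Simányi 2013) is NOT vendored in this
  file: the definitions do not presuppose it (they are meaningful, and `IsURegular` has teeth —
  it fails for every nonzero law when plaques are points), and the printed theorems (dimension,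
  smoothness class, size functions) must be quoted from the sources, which are not held at the
  time of writing; a `cite` item should add them as named facts next to these definitions.
* *Homogeneity strips* (Chernov; Bálint–Chernov–Szász–Tóth 2002) are not needed to STATE
  u-regularity as pure absolute continuity: refining a subordinate partition by a countable
  measurable partition keeps it subordinate off the strip boundaries, and `≪` is insensitive to
  it. Strips enter only quantitative density classes (standard pairs / growth lemmas), which the
  route deliberately does not demand ("no uniform log-Hölder constant"); they belong with the
  collision-statistics items (TemperedCollisions) and are left to a later file.
* *Infinite volume.* The route's posited notion (u-regularity of a law on `PointConfig (ℝ³ × ℝ³)`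
  on "local unstable plaques of a finite particle window with the exterior held to its backward
  data") requires a window dynamics in a prescribed moving environment that
  `Literature.Analysis.FluidPDE.InfiniteHardSphereFlow` does not provide (Alexander's partial
  flows were deliberately left out of D1), and the naive slice of the infinite-dimensional
  unstable set by "perturb only the window" is generically trivial (finitely many unknowns,
  infinitely many constraints). What IS literature-grade and is provided: `PlaqueFamily`,
  `IsURegular`, `HasACCondMeasures`, mixtures and covariance are stated for an ARBITRARY plaque
  family on an arbitrary (standard Borel) space, so the route's `…Defs.lean` only has to supply
  its plaque family on `PointConfig`; `uRegularStates L` is then its class of u-regular states.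
  The "sanity fact" that hard-sphere Gibbs states are u-regular is a claim about that posited
  object with no printed source and is not vendored.

## References

* F. Ledrappier, L.-S. Young, *The metric entropy of diffeomorphisms I*, Ann. Math. 122 (1985),
  (1.2) p. 512 (unstable set), (1.3) p. 512 (measurable partitions, conditional measures),
  Def. 1.4.1–1.4.2 p. 513 (subordinate partitions; a.c. conditional measures) [LedrappierYoung1985].
* L. Barreira, Ya. Pesin, *Introduction to Smooth Ergodic Theory*, 2nd ed. (2023), §8.1 (8.1)
  (conditional measures on foliation blocks, leaf volume), §9.1.1, §11.1.2 (SRB measures)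
  [BarreiraPesin2023].
* Ya. B. Pesin, Ya. G. Sinai, *Gibbs measures for partially hyperbolic attractors*, ETDS 2 (1982)
  (u-Gibbs measures) [PesinSinai1982].
* Ya. G. Sinai, N. I. Chernov, Russ. Math. Surveys 42:3 (1987) [SinaiChernov1987];
  A. Katok, J.-M. Strelcyn et al., LNM 1222 (1986) [KatokEtAl1986];
  P. Bálint, N. Chernov, D. Szász, I. P. Tóth, AHP 3 (2002) [BalintEtAl2002].
-/

noncomputable section

open MeasureTheory ProbabilityTheory Set Filter Metric Function
open scoped ENNReal NNReal Topology

namespace Literature.Dynamics.Billiards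

/-! ## 1. Conditional measures on a measurable partition (`condExpKernel` on a sub-σ-algebra) -/

section CondKernel

variable {Ω : Type*} {m : MeasurableSpace Ω} [mΩ : MeasurableSpace Ω] [StandardBorelSpace Ω]
  (μ : Measure Ω) [IsFiniteMeasure μ]

/-- **Defining identity of the conditional kernel on rectangles**: for `B ∈ m` and measurable `C`,
`∫_B π^ω(C) μ(dω) = μ(B ∩ C)` where `π = condExpKernel μ m` (Ledrappier–Young 1985 (1.3):
`x ↦ m_x^ξ(A)` is `𝓜_ξ`-measurable and `m(A) = ∫ m_x^ξ(A) m(dx)`, here localised to `B ∈ 𝓜_ξ`;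
from Mathlib's `compProd_trim_condExpKernel`). [cite: LedrappierYoung1985, (1.3) p. 512] -/
theorem setLIntegral_condExpKernel_eq (hm : m ≤ mΩ) {B C : Set Ω} (hB : MeasurableSet[m] B)
    (hC : MeasurableSet C) :
    ∫⁻ ω in B, condExpKernel μ m ω C ∂μ = μ (B ∩ C) := by
  have key := compProd_trim_condExpKernel (μ := μ) (m := m) hm
  have hrect := Measure.compProd_apply_prod (μ := μ.trim hm) (κ := condExpKernel μ m) hB hC
  have hdiag : @Measurable Ω (Ω × Ω) mΩ (m.prod mΩ) (fun ω => (id ω, id ω)) :=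
    (measurable_id.mono le_rfl hm).prodMk measurable_id
  rw [← setLIntegral_trim hm (measurable_condExpKernel hC) hB, ← hrect, key,
    Measure.map_apply hdiag (hB.prod hC)]
  rfl

/-- **Barycentre formula** (disintegration of `μ` along the partition): `μ = ∫ π^ω μ(dω)`, i.e.
`μ.bind (condExpKernel μ m) = μ` (Ledrappier–Young 1985 (1.3) with `A` arbitrary; Rokhlin).
[cite: LedrappierYoung1985, (1.3) p. 512] -/
theorem bind_condExpKernel (hm : m ≤ mΩ) : μ.bind (condExpKernel μ m) = μ := by
  have hmeas : Measurable (condExpKernel μ m : Ω → Measure Ω) :=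
    (condExpKernel μ m).measurable.mono hm le_rfl
  ext C hC
  rw [Measure.bind_apply hC hmeas.aemeasurable]
  have h := setLIntegral_condExpKernel_eq μ hm (@MeasurableSet.univ Ω m) hC
  rwa [Measure.restrict_univ, Set.univ_inter] at h

/-- **Properness**: for an element `B ∈ m` of the partition σ-algebra, `π^ω(B) = 1_B(ω)` for
`μ`-a.e. `ω` (the conditional measure sees on which side of `B` its base point lies).
[cite: LedrappierYoung1985, (1.3) p. 512] -/
theorem condExpKernel_apply_ae_eq_indicator (hm : m ≤ mΩ) {B : Set Ω}
    (hB : MeasurableSet[m] B) :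
    ∀ᵐ ω ∂μ, condExpKernel μ m ω B = B.indicator 1 ω := by
  have hBm : MeasurableSet B := hm _ hB
  have h1 : ∀ᵐ ω ∂μ, ω ∈ B → condExpKernel μ m ω Bᶜ = 0 := by
    rw [← ae_restrict_iff' hBm]
    refine (lintegral_eq_zero_iff ((measurable_condExpKernel hBm.compl).mono hm le_rfl)).1 ?_
    rw [setLIntegral_condExpKernel_eq μ hm hB hBm.compl, Set.inter_compl_self, measure_empty]
  have h2 : ∀ᵐ ω ∂μ, ω ∈ Bᶜ → condExpKernel μ m ω B = 0 := by
    rw [← ae_restrict_iff' hBm.compl]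
    refine (lintegral_eq_zero_iff ((measurable_condExpKernel hBm).mono hm le_rfl)).1 ?_
    rw [setLIntegral_condExpKernel_eq μ hm hB.compl hBm, Set.compl_inter_self, measure_empty]
  filter_upwards [h1, h2] with ω hω1 hω2
  by_cases hω : ω ∈ B
  · rw [Set.indicator_of_mem hω, Pi.one_apply, ← prob_compl_eq_zero_iff hBm]
    exact hω1 hω
  · rw [Set.indicator_of_notMem hω]
    exact hω2 hω

/-- **Conditional measures are carried by the atoms** (Rokhlin; Ledrappier–Young 1985 (1.3):
"for every `x` in a set of full measure there is a probability measure `m_x^ξ` defined on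
`ξ(x)`"): if the partition σ-algebra `m` is countably generated, then for `μ`-a.e. `ω` the
conditional measure `π^ω` gives full mass to the atom of `m` through `ω`. Proof: the atom is the
countable intersection of the generators (or their complements) containing `ω`
(`measurableAtom_eq_countablyGeneratedAtom_natGeneratingSequence`), each of which has
`π^ω`-mass one a.s. by properness. [cite: LedrappierYoung1985, (1.3) p. 512] -/
theorem ae_condExpKernel_measurableAtom_eq_one (hm : m ≤ mΩ)
    (hcg : @MeasurableSpace.CountablyGenerated Ω m) :
    ∀ᵐ ω ∂μ, condExpKernel μ m ω (@measurableAtom Ω m ω) = 1 := by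
  classical
  set A : ℕ → Set Ω := @MeasurableSpace.natGeneratingSequence Ω m hcg
  have hA : ∀ n, MeasurableSet[m] (A n) := fun n =>
    @MeasurableSpace.measurableSet_natGeneratingSequence Ω m hcg n
  have hall : ∀ᵐ ω ∂μ, ∀ n, condExpKernel μ m ω (A n) = (A n).indicator 1 ω ∧
      condExpKernel μ m ω (A n)ᶜ = (A n)ᶜ.indicator 1 ω := by
    rw [ae_all_iff]
    intro n
    filter_upwards [condExpKernel_apply_ae_eq_indicator μ hm (hA n),
      condExpKernel_apply_ae_eq_indicator μ hm (hA n).compl] with ω h1 h2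
    exact ⟨h1, h2⟩
  filter_upwards [hall] with ω hω
  have hatom : @measurableAtom Ω m ω = ⋂ n, (if ω ∈ A n then A n else (A n)ᶜ) :=
    @MeasurableSpace.measurableAtom_eq_countablyGeneratedAtom_natGeneratingSequence Ω m hcg ω
  have hmeas : MeasurableSet (@measurableAtom Ω m ω) :=
    hm _ (@MeasurableSpace.measurableSet_measurableAtom Ω m hcg ω)
  rw [← prob_compl_eq_zero_iff hmeas, hatom, Set.compl_iInter, measure_iUnion_null_iff]
  intro n
  by_cases hn : ω ∈ A n
  · have h := (hω n).2
    rw [Set.indicator_of_notMem (Set.notMem_compl_iff.2 hn)] at h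
    simpa only [if_pos hn] using h
  · have h := (hω n).1
    rw [Set.indicator_of_notMem hn] at h
    simpa only [if_neg hn, compl_compl] using h

end CondKernel

/-! ## 2. Measurable partitions, plaque families, the two absolute-continuity notions -/

section Partition

variable {α : Type*} [mα : MeasurableSpace α]

variable (α) in
/-- A **measurable partition** of `α` in Rokhlin's sense, encoded by the σ-algebra of its
measurable saturated sets: a countably generated sub-σ-algebra `sigma ≤ mα` (Ledrappier–Young
1985 (1.3): "the quotient `M/ξ` is separated by a countable number of measurable sets"; the
element of the partition through `x` is the atom of `sigma` at `x`, `MeasurablePartition.atom`).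
A structure rather than a bare `MeasurableSpace α` so that it never becomes a local instance.
[cite: LedrappierYoung1985, (1.3) p. 512] -/
structure MeasurablePartition where
  /-- The σ-algebra of measurable unions of partition elements. -/
  sigma : MeasurableSpace α
  /-- It is a sub-σ-algebra of the ambient one. -/
  sigma_le : sigma ≤ mα
  /-- It is countably generated (the partition is countably separated). -/
  countablyGenerated : @MeasurableSpace.CountablyGenerated α sigma

namespace MeasurablePartition

/-- The element `ξ(x)` of the partition through `x`: the atom of `ξ.sigma` at `x`. [cite: LedrappierYoung1985, (1.3) p. 512] -/
def atom (ξ : MeasurablePartition α) (x : α) : Set α :=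
  @measurableAtom α ξ.sigma x

/-- Every point lies in its own partition element. [folklore] -/
theorem mem_atom_self (ξ : MeasurablePartition α) (x : α) : x ∈ ξ.atom x :=
  @mem_measurableAtom_self α ξ.sigma x

/-- Partition elements are measurable (countable generation). [folklore] -/
theorem measurableSet_atom (ξ : MeasurablePartition α) (x : α) : MeasurableSet (ξ.atom x) :=
  ξ.sigma_le _ (@MeasurableSpace.measurableSet_measurableAtom α ξ.sigma ξ.countablyGenerated x)

/-- The partition into the fibres of a measurable map to a countably generated measurable space
(e.g. a standard Borel space): `ξ(x) = f ⁻¹' {f x}` when points of `β` are measurable.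
[folklore] -/
def comap {β : Type*} [MeasurableSpace β] [MeasurableSpace.CountablyGenerated β] (f : α → β)
    (hf : Measurable f) : MeasurablePartition α where
  sigma := MeasurableSpace.comap f inferInstance
  sigma_le := hf.comap_le
  countablyGenerated := MeasurableSpace.CountablyGenerated.comap f

variable [StandardBorelSpace α]

/-- The **canonical system of conditional measures** of a finite measure `μ` with respect to the
measurable partition `ξ` (Rokhlin; Ledrappier–Young 1985 (1.3)): Mathlib's regular conditional
probability kernel `condExpKernel μ ξ.sigma`, evaluated at `x`. [cite: LedrappierYoung1985, (1.3) p. 512] -/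
def condMeasure (ξ : MeasurablePartition α) (μ : Measure α) [IsFiniteMeasure μ] (x : α) :
    Measure α :=
  condExpKernel μ ξ.sigma x

variable (ξ : MeasurablePartition α) (μ : Measure α) [IsFiniteMeasure μ]

/-- Unfolding lemma for `condMeasure`. [folklore] -/
theorem condMeasure_apply (x : α) : ξ.condMeasure μ x = condExpKernel μ ξ.sigma x := rfl

/-- Conditional measures are probability measures. [folklore] -/
instance isProbabilityMeasure_condMeasure (x : α) : IsProbabilityMeasure (ξ.condMeasure μ x) := by
  rw [condMeasure_apply]
  infer_instance

/-- `x ↦ μ_x^ξ` is measurable (indeed `ξ.sigma`-measurable). [folklore] -/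
theorem measurable_condMeasure : Measurable (ξ.condMeasure μ) :=
  (condExpKernel μ ξ.sigma).measurable.mono ξ.sigma_le le_rfl

/-- **Disintegration** `μ = ∫ μ_x^ξ μ(dx)` (LY (1.3): `m(A) = ∫ m_x^ξ(A) m(dx)`). [cite: LedrappierYoung1985, (1.3) p. 512] -/
theorem bind_condMeasure : μ.bind (ξ.condMeasure μ) = μ :=
  bind_condExpKernel μ ξ.sigma_le

/-- `μ(A) = ∫ μ_x^ξ(A) μ(dx)` for measurable `A`. [cite: LedrappierYoung1985, (1.3) p. 512] -/
theorem lintegral_condMeasure_apply {A : Set α} (hA : MeasurableSet A) :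
    ∫⁻ x, ξ.condMeasure μ x A ∂μ = μ A := by
  conv_rhs => rw [← bind_condMeasure ξ μ]
  rw [Measure.bind_apply hA (measurable_condMeasure ξ μ).aemeasurable]

/-- **Conditional measures live on partition elements**: `μ_x^ξ(ξ(x)) = 1` for `μ`-a.e. `x`.
[cite: LedrappierYoung1985, (1.3) p. 512] -/
theorem ae_condMeasure_atom_eq_one : ∀ᵐ x ∂μ, ξ.condMeasure μ x (ξ.atom x) = 1 :=
  ae_condExpKernel_measurableAtom_eq_one μ ξ.sigma_le ξ.countablyGenerated

end MeasurablePartition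

/-- A **plaque family** on a measurable space: to every point `x` a plaque `W(x) ⊆ α` through it
(intended: a local unstable manifold) and a reference *leaf measure* `m_x` (intended: the leaf
volume of `W(x)`, or any measure with the same null sets on `W(x)`, e.g. a Hausdorff measure).
Only the null sets of `m_x` on `W(x)` matter below. This is the datum "the collection
`{W^u(x)}` … with its inherited Riemannian measure `μ_x^{W^u}`" of Ledrappier–Young 1985 (1.2),
abstracted so that it applies verbatim to billiard flows and to configuration spaces of
infinitely many particles. [cite: LedrappierYoung1985, (1.2) p. 512] -/
structure PlaqueFamily (α : Type*) [MeasurableSpace α] where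
  /-- The plaque (local leaf) through `x`. -/
  plaque : α → Set α
  /-- The reference leaf measure attached to `x` (only its null sets on `plaque x` matter). -/
  leafMeasure : α → Measure α

namespace PlaqueFamily

/-- A measurable partition `ξ` is **subordinate** to the plaque family `L` with respect to `μ`
(Ledrappier–Young 1985, Def. 1.4.1): for `μ`-a.e. `x` the partition element `ξ(x)` (1) lies in
the plaque `W(x)` and (2) contains a neighbourhood of `x` in `W(x)` (subspace topology; see the
module docstring). [cite: LedrappierYoung1985, Def. 1.4.1 p. 513] -/
def IsSubordinate [TopologicalSpace α] (L : PlaqueFamily α) (μ : Measure α)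
    (ξ : MeasurablePartition α) : Prop :=
  ∀ᵐ x ∂μ, ξ.atom x ⊆ L.plaque x ∧ ∃ U ∈ 𝓝 x, U ∩ L.plaque x ⊆ ξ.atom x

/-- `μ` **has absolutely continuous conditional measures on the plaques** of `L`
(Ledrappier–Young 1985, Def. 1.4.2 — the defining property of SRB / u-Gibbs measures,
Pesin–Sinai 1982): for every measurable partition `ξ` subordinate to `L`, the conditional
measure `μ_x^ξ` is absolutely continuous with respect to the leaf measure `m_x`, for `μ`-a.e.
`x`. As in the source this quantifies over subordinate partitions and is vacuous if there are
none (their existence is part of the invariant-manifold theory, LY Lemma 3.1.1); the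
partition-free `IsURegular` below is the form with unconditional content.
[cite: LedrappierYoung1985, Def. 1.4.2 p. 513] -/
def HasACCondMeasures [TopologicalSpace α] [StandardBorelSpace α] (L : PlaqueFamily α)
    (μ : Measure α) [IsFiniteMeasure μ] : Prop :=
  ∀ ξ : MeasurablePartition α, L.IsSubordinate μ ξ → ∀ᵐ x ∂μ, ξ.condMeasure μ x ≪ L.leafMeasure x

/-- `μ` is **u-regular** for the plaque family `L` (partition-free form of "absolutely
continuous conditional measures on plaques"): `μ` charges no measurable set which is
leaf-null on `μ`-almost every plaque — `m_x (s ∩ W(x)) = 0` for `μ`-a.e. `x` implies `μ s = 0`.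
`HasACCondMeasures.isURegular` derives it from LY's Def. 1.4.2 given one subordinate partition;
conversely, Lebesgue-decomposing the conditional measures along a subordinate partition and
collecting the singular parts into one measurable leafwise-null set gives LY's property back
(standard; not used here). Teeth: if `W(x)` is `m_x`-null for `μ`-many `x` (no expansion, or a
leaf measure of too large a dimension), every `s` qualifies and only `μ = 0` is u-regular.
[cite: LedrappierYoung1985, Def. 1.4.2 p. 513] -/
def IsURegular (L : PlaqueFamily α) (μ : Measure α) : Prop :=
  ∀ s : Set α, MeasurableSet s → (∀ᵐ x ∂μ, L.leafMeasure x (s ∩ L.plaque x) = 0) → μ s = 0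

/-- The zero measure is u-regular. [folklore] -/
theorem isURegular_zero (L : PlaqueFamily α) : L.IsURegular 0 := fun _ _ _ => rfl

/-- u-regularity is preserved by scalar multiples. [folklore] -/
theorem IsURegular.smul {L : PlaqueFamily α} {μ : Measure α} (h : L.IsURegular μ) (c : ℝ≥0∞) :
    L.IsURegular (c • μ) := by
  intro s hs hnull
  rw [ae_iff, Measure.smul_apply, smul_eq_mul, mul_eq_zero] at hnull
  rw [Measure.smul_apply, smul_eq_mul, mul_eq_zero]
  rcases hnull with hc | hnull
  · exact Or.inl hc
  · exact Or.inr (h s hs (ae_iff.2 hnull))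

/-- **Convexity, finite form**: the sum of two u-regular measures is u-regular. [folklore] -/
theorem IsURegular.add {L : PlaqueFamily α} {μ ν : Measure α} (hμ : L.IsURegular μ)
    (hν : L.IsURegular ν) : L.IsURegular (μ + ν) := by
  intro s hs hnull
  rw [ae_add_measure_iff] at hnull
  simp [hμ s hs hnull.1, hν s hs hnull.2]

/-- **Convexity, integral form (mixtures)**: if `P`-almost every law `κ i` of a measurable
family is u-regular, so is the mixture `∫ κ i P(di) = P.bind κ` (e.g. an integral over ergodic
or Gibbs components). [folklore] -/
theorem IsURegular.bind {ι : Type*} [MeasurableSpace ι] {L : PlaqueFamily α} {P : Measure ι}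
    {κ : Kernel ι α} (h : ∀ᵐ i ∂P, L.IsURegular (κ i)) : L.IsURegular (P.bind κ) := by
  intro s hs hnull
  rw [ae_iff] at hnull
  obtain ⟨N, hsub, hN, hN0⟩ := exists_measurable_superset_of_null hnull
  rw [Measure.bind_apply hN κ.aemeasurable] at hN0
  have hN0' : ∀ᵐ i ∂P, κ i N = 0 := (lintegral_eq_zero_iff (κ.measurable_coe hN)).1 hN0
  rw [Measure.bind_apply hs κ.aemeasurable]
  refine (lintegral_eq_zero_iff (κ.measurable_coe hs)).2 ?_
  filter_upwards [h, hN0'] with i hi hiN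
  refine hi s hs ?_
  rw [ae_iff]
  exact measure_mono_null hsub hiN

/-- **Covariance**: the push-forward of a law u-regular for `L` under a measurable symmetry `e`
that maps the plaques of `L` to those of `L'` (`e (W(x)) = W'(e x)`) and `L`-leaf-null sets to
`L'`-leaf-null sets is u-regular for `L'`.
Used with isometries commuting with a flow (translations of all particles, for hard balls).
[folklore] -/
theorem IsURegular.map_equiv {L L' : PlaqueFamily α} {μ : Measure α} (h : L.IsURegular μ)
    (e : α ≃ᵐ α) (hplaque : ∀ x, e ⁻¹' L'.plaque (e x) = L.plaque x)
    (hleaf : ∀ x, (L.leafMeasure x).map e ≪ L'.leafMeasure (e x)) :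
    L'.IsURegular (μ.map e) := by
  intro s hs hnull
  rw [e.map_apply]
  refine h _ (hs.preimage e.measurable) ?_
  rw [← e.map_ae] at hnull
  filter_upwards [Filter.eventually_map.1 hnull] with x hx
  have hset : e ⁻¹' s ∩ L.plaque x = e ⁻¹' (s ∩ L'.plaque (e x)) := by
    rw [Set.preimage_inter, hplaque]
  rw [hset, ← e.map_apply]
  exact hleaf x hx

/-- **LY ⇒ transversal**: if `μ` has absolutely continuous conditional measures on the plaques of
`L` (Def. 1.4.2) and at least one measurable partition subordinate to `L` exists, then `μ` is
u-regular. Proof: disintegrate `μ s = ∫ μ_x^ξ(s) μ(dx)`; a.e. `μ_x^ξ` is carried by `ξ(x) ⊆ W(x)`,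
so `μ_x^ξ(s) ≤ μ_x^ξ(s ∩ W(x)) = 0` by `μ_x^ξ ≪ m_x`. [cite: LedrappierYoung1985, Def. 1.4.2 p. 513] -/
theorem HasACCondMeasures.isURegular [TopologicalSpace α] [StandardBorelSpace α]
    {L : PlaqueFamily α} {μ : Measure α} [IsFiniteMeasure μ] (h : L.HasACCondMeasures μ)
    {ξ : MeasurablePartition α} (hξ : L.IsSubordinate μ ξ) : L.IsURegular μ := by
  intro s hs hnull
  have hmeas : Measurable fun x => ξ.condMeasure μ x s :=
    (measurable_condExpKernel hs).mono ξ.sigma_le le_rfl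
  rw [← ξ.lintegral_condMeasure_apply μ hs, lintegral_eq_zero_iff hmeas]
  filter_upwards [h ξ hξ, hξ, hnull, ξ.ae_condMeasure_atom_eq_one μ] with x hx hxsub hxnull
    hatom
  have h0 : ξ.condMeasure μ x (ξ.atom x)ᶜ = 0 :=
    (prob_compl_eq_zero_iff (ξ.measurableSet_atom x)).2 hatom
  have h1 : ξ.condMeasure μ x (s ∩ L.plaque x) = 0 := hx hxnull
  have hle' : ξ.condMeasure μ x s ≤
      ξ.condMeasure μ x (s ∩ L.plaque x) + ξ.condMeasure μ x (ξ.atom x)ᶜ := by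
    refine (measure_mono fun y hy => ?_).trans (measure_union_le _ _)
    by_cases hy' : y ∈ ξ.atom x
    · exact Or.inl ⟨hy, hxsub.1 hy'⟩
    · exact Or.inr hy'
  rw [h0, h1, add_zero] at hle'
  exact le_antisymm hle' bot_le

/-- The **u-regular states** of a plaque family: probability laws that are u-regular (the class
in which route UGibbsRigidity poses the Boltzmann hypothesis; for the unstable plaques of a
`C²` diffeomorphism these are the measures with absolutely continuous conditional measures on
unstable manifolds of Ledrappier–Young 1985, Def. 1.4.2). [cite: LedrappierYoung1985, Def. 1.4.2 p. 513] -/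
def uRegularStates (L : PlaqueFamily α) : Set (Measure α) :=
  {ν | IsProbabilityMeasure ν ∧ L.IsURegular ν}

/-- Membership in the set of u-regular states. [folklore] -/
theorem mem_uRegularStates_iff {L : PlaqueFamily α} {ν : Measure α} :
    ν ∈ L.uRegularStates ↔ IsProbabilityMeasure ν ∧ L.IsURegular ν :=
  Iff.rfl

/-- **Convexity of the set of u-regular states**: mixtures `a ν₁ + b ν₂` (`a, b ≥ 0`,
`a + b = 1`) of u-regular states are u-regular states. [folklore] -/
theorem convex_uRegularStates (L : PlaqueFamily α) : Convex ℝ≥0 L.uRegularStates := by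
  intro ν₁ h₁ ν₂ h₂ a b _ _ hab
  have ha : (a • ν₁ : Measure α) = (a : ℝ≥0∞) • ν₁ := rfl
  have hb : (b • ν₂ : Measure α) = (b : ℝ≥0∞) • ν₂ := rfl
  refine ⟨⟨?_⟩, ?_⟩
  · haveI := h₁.1
    haveI := h₂.1
    rw [ha, hb, Measure.add_apply, Measure.smul_apply, Measure.smul_apply, measure_univ,
      measure_univ, smul_eq_mul, smul_eq_mul, mul_one, mul_one, ← ENNReal.coe_add, hab,
      ENNReal.coe_one]
  · rw [ha, hb]
    exact (h₁.2.smul _).add (h₂.2.smul _)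

end PlaqueFamily

/-- A **u-regular state** of the plaque family `L`, as a type: a probability law on `α` that is
u-regular for `L` (an element of the convex set `L.uRegularStates`). [cite: LedrappierYoung1985, Def. 1.4.2 p. 513] -/
abbrev URegularState (L : PlaqueFamily α) : Type _ :=
  L.uRegularStates

end Partition

/-! ## 3. Unstable sets and unstable plaques of a measurable flow on a metric space -/

section Flow

variable {α : Type*}

section Pseudo

variable [PseudoMetricSpace α]

/-- The **(strong) unstable set** of `z` for the time-`t` maps `T : ℝ → α → α` (a flow, possibly
defined only almost everywhere; backward evolution is `T (-t)`): the points whose backward orbit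
converges exponentially fast to that of `z`,
`W^u(z) = {y | limsup_{t → ∞} t⁻¹ log dist (T₋ₜ y, T₋ₜ z) < 0}`, written as: for some rate
`r > 0`, `dist (T₋ₜ y) (T₋ₜ z) ≤ e^{-r t}` for all large `t` (Ledrappier–Young 1985 (1.2), with
`f⁻ⁿ` replaced by `T₋ₜ`). [cite: LedrappierYoung1985, (1.2) p. 512] -/
def unstableSet (T : ℝ → α → α) (z : α) : Set α :=
  {y | ∃ r : ℝ, 0 < r ∧ ∀ᶠ t : ℝ in atTop, dist (T (-t) y) (T (-t) z) ≤ Real.exp (-(r * t))}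

/-- The **local unstable set of size `δ`** of `z`: the points of the unstable set of `z` whose
backward orbit moreover stays `δ`-close to that of `z` at all times `t ≥ 0` — the set of points
of the local unstable manifold `W^u_δ(z)` through `z` whenever the latter exists (the definitions
below do not presuppose that it does). [cite: LedrappierYoung1985, (1.2) p. 512] -/
def localUnstableSet (T : ℝ → α → α) (δ : ℝ) (z : α) : Set α :=
  {y | y ∈ unstableSet T z ∧ ∀ t : ℝ, 0 ≤ t → dist (T (-t) y) (T (-t) z) ≤ δ}

variable {T : ℝ → α → α} {z y : α} {δ δ' : ℝ}

/-- Membership in the unstable set. [folklore] -/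
theorem mem_unstableSet_iff : y ∈ unstableSet T z ↔
    ∃ r : ℝ, 0 < r ∧ ∀ᶠ t : ℝ in atTop, dist (T (-t) y) (T (-t) z) ≤ Real.exp (-(r * t)) :=
  Iff.rfl

/-- Membership in the local unstable set. [folklore] -/
theorem mem_localUnstableSet_iff : y ∈ localUnstableSet T δ z ↔
    y ∈ unstableSet T z ∧ ∀ t : ℝ, 0 ≤ t → dist (T (-t) y) (T (-t) z) ≤ δ :=
  Iff.rfl

/-- Every point lies in its own unstable set. [folklore] -/
theorem self_mem_unstableSet (T : ℝ → α → α) (z : α) : z ∈ unstableSet T z :=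
  ⟨1, one_pos, Eventually.of_forall fun t => by rw [dist_self]; exact (Real.exp_pos _).le⟩

/-- The unstable relation is symmetric. [folklore] -/
theorem mem_unstableSet_comm : y ∈ unstableSet T z ↔ z ∈ unstableSet T y := by
  simp only [mem_unstableSet_iff, dist_comm]

/-- Local unstable sets are contained in the unstable set. [folklore] -/
theorem localUnstableSet_subset_unstableSet : localUnstableSet T δ z ⊆ unstableSet T z :=
  fun _ h => h.1

/-- Every point lies in its own local unstable set of nonnegative size. [folklore] -/
theorem self_mem_localUnstableSet (T : ℝ → α → α) (hδ : 0 ≤ δ) (z : α) :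
    z ∈ localUnstableSet T δ z :=
  ⟨self_mem_unstableSet T z, fun t _ => by rw [dist_self]; exact hδ⟩

/-- Local unstable sets increase with their size. [folklore] -/
theorem localUnstableSet_mono (h : δ ≤ δ') : localUnstableSet T δ z ⊆ localUnstableSet T δ' z :=
  fun _ hy => ⟨hy.1, fun t ht => (hy.2 t ht).trans h⟩

/-- At time `0`: if `T₀ = id`, the local unstable set of size `δ` lies in the closed `δ`-ball.
[folklore] -/
theorem dist_le_of_mem_localUnstableSet (h0 : ∀ x, T 0 x = x)
    (hy : y ∈ localUnstableSet T δ z) : dist y z ≤ δ := by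
  simpa only [neg_zero, h0] using hy.2 0 le_rfl

/-- **Equivariance**: an isometry commuting with the time maps pulls the unstable set of `g z`
back to the unstable set of `z`. [folklore] -/
theorem preimage_unstableSet_of_isometry {g : α → α} (hg : Isometry g)
    (hcomm : ∀ t x, T t (g x) = g (T t x)) (z : α) :
    g ⁻¹' unstableSet T (g z) = unstableSet T z := by
  ext y
  simp only [mem_preimage, mem_unstableSet_iff, hcomm, hg.dist_eq]

/-- **Equivariance** of local unstable sets under isometries commuting with the time maps.
[folklore] -/
theorem preimage_localUnstableSet_of_isometry {g : α → α} (hg : Isometry g)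
    (hcomm : ∀ t x, T t (g x) = g (T t x)) (δ : ℝ) (z : α) :
    g ⁻¹' localUnstableSet T δ (g z) = localUnstableSet T δ z := by
  ext y
  have h1 : g y ∈ unstableSet T (g z) ↔ y ∈ unstableSet T z := by
    rw [← mem_preimage, preimage_unstableSet_of_isometry hg hcomm]
  simp only [mem_preimage, mem_localUnstableSet_iff, h1, hcomm, hg.dist_eq]

end Pseudo

section Metric

variable [MetricSpace α] [MeasurableSpace α] [BorelSpace α]

/-- The **unstable plaque family** of the time maps `T` with (measurable) size function `δ` and
leaf dimension `k`: the plaque through `z` is the local unstable set `W^u_{δ(z)}(z)` and the leaf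
measure is the `k`-dimensional Hausdorff measure `μH[k]` (equivalent, with locally bounded
densities, to the leaf volume on any `k`-dimensional `C¹` plaque of a space locally bi-Lipschitz
to a Euclidean space; Ledrappier–Young's `μ_x^{W^u}`). [cite: LedrappierYoung1985, (1.2) p. 512] -/
def unstablePlaques (T : ℝ → α → α) (δ : α → ℝ) (k : ℝ) : PlaqueFamily α where
  plaque z := localUnstableSet T (δ z) z
  leafMeasure _ := μH[k]

/-- Unfolding lemma: the plaques of `unstablePlaques`. [folklore] -/
@[simp]
theorem unstablePlaques_plaque (T : ℝ → α → α) (δ : α → ℝ) (k : ℝ) (z : α) :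
    (unstablePlaques T δ k).plaque z = localUnstableSet T (δ z) z :=
  rfl

/-- Unfolding lemma: the leaf measures of `unstablePlaques`. [folklore] -/
@[simp]
theorem unstablePlaques_leafMeasure (T : ℝ → α → α) (δ : α → ℝ) (k : ℝ) (z : α) :
    (unstablePlaques T δ k).leafMeasure z = μH[k] :=
  rfl

/-- `μ` is **u-Gibbs of dimension `k`** for the time maps `T` (Ledrappier–Young 1985 Def. 1.4.2
along the unstable plaques of `T`, the SRB / u-Gibbs property of Pesin–Sinai 1982): for every
measurable size function `δ > 0` and every measurable partition subordinate to the plaques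
`W^u_{δ(x)}(x)`, the conditional measures are absolutely continuous with respect to `μH[k]`,
`μ`-almost everywhere. [cite: LedrappierYoung1985, Def. 1.4.2 p. 513] -/
def IsUGibbsOfDim [StandardBorelSpace α] (T : ℝ → α → α) (k : ℝ) (μ : Measure α)
    [IsFiniteMeasure μ] : Prop :=
  ∀ δ : α → ℝ, Measurable δ → (∀ z, 0 < δ z) → (unstablePlaques T δ k).HasACCondMeasures μ

/-- `μ` is **u-regular of dimension `k`** for the time maps `T` (partition-free form): for every
measurable size function `δ > 0`, `μ` charges no measurable set which is `μH[k]`-null on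
`μ`-almost every plaque `W^u_{δ(x)}(x)`. [cite: LedrappierYoung1985, Def. 1.4.2 p. 513] -/
def IsURegularOfDim (T : ℝ → α → α) (k : ℝ) (μ : Measure α) : Prop :=
  ∀ δ : α → ℝ, Measurable δ → (∀ z, 0 < δ z) → (unstablePlaques T δ k).IsURegular μ

variable {T : ℝ → α → α} {k : ℝ}

/-- **LY ⇒ transversal** for flows: a u-Gibbs measure of dimension `k` is u-regular of dimension
`k` as soon as subordinate partitions exist for every size function (which is where the
existence theorem for local unstable manifolds enters). [cite: LedrappierYoung1985, Def. 1.4.2 p. 513] -/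
theorem IsUGibbsOfDim.isURegularOfDim [StandardBorelSpace α] {μ : Measure α} [IsFiniteMeasure μ]
    (h : IsUGibbsOfDim T k μ)
    (hex : ∀ δ : α → ℝ, Measurable δ → (∀ z, 0 < δ z) →
      ∃ ξ : MeasurablePartition α, (unstablePlaques T δ k).IsSubordinate μ ξ) :
    IsURegularOfDim T k μ := by
  intro δ hδm hδ
  obtain ⟨ξ, hξ⟩ := hex δ hδm hδ
  exact (h δ hδm hδ).isURegular hξ

/-- Sums of u-regular measures are u-regular. [folklore] -/
theorem IsURegularOfDim.add {μ ν : Measure α} (hμ : IsURegularOfDim T k μ)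
    (hν : IsURegularOfDim T k ν) : IsURegularOfDim T k (μ + ν) :=
  fun δ hδm hδ => (hμ δ hδm hδ).add (hν δ hδm hδ)

/-- Scalar multiples of u-regular measures are u-regular. [folklore] -/
theorem IsURegularOfDim.smul {μ : Measure α} (hμ : IsURegularOfDim T k μ) (c : ℝ≥0∞) :
    IsURegularOfDim T k (c • μ) :=
  fun δ hδm hδ => (hμ δ hδm hδ).smul c

/-- **Mixtures** of u-regular measures are u-regular. [folklore] -/
theorem IsURegularOfDim.bind {ι : Type*} [MeasurableSpace ι] {P : Measure ι} {κ : Kernel ι α}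
    (h : ∀ᵐ i ∂P, IsURegularOfDim T k (κ i)) : IsURegularOfDim T k (P.bind κ) :=
  fun δ hδm hδ => PlaqueFamily.IsURegular.bind (by
    filter_upwards [h] with i hi
    exact hi δ hδm hδ)

/-- **Covariance under symmetries of the flow**: if `g` is a (surjective) isometry of `α`
commuting with every time map, the push-forward of a u-regular measure is u-regular (the
unstable plaques are `g`-equivariant and `μH[k]` is `g`-invariant). Translations of all particles
of a hard-ball system are such symmetries. [folklore] -/
theorem IsURegularOfDim.map_isometryEquiv {μ : Measure α} (h : IsURegularOfDim T k μ)
    (g : α ≃ᵢ α) (hcomm : ∀ t x, T t (g x) = g (T t x)) : IsURegularOfDim T k (μ.map g) := by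
  intro δ hδm hδ
  have h' := h (δ ∘ g) (hδm.comp g.continuous.measurable) fun z => hδ (g z)
  have key := h'.map_equiv (L' := unstablePlaques T δ k) g.toHomeomorph.toMeasurableEquiv
    (fun x => ?_) (fun x => ?_)
  · simpa only [Homeomorph.toMeasurableEquiv_coe, IsometryEquiv.coe_toHomeomorph] using key
  · simp only [Homeomorph.toMeasurableEquiv_coe, IsometryEquiv.coe_toHomeomorph,
      unstablePlaques_plaque, Function.comp_apply]
    exact preimage_localUnstableSet_of_isometry g.isometry hcomm _ x
  · simp only [Homeomorph.toMeasurableEquiv_coe, IsometryEquiv.coe_toHomeomorph,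
      unstablePlaques_leafMeasure, g.map_hausdorffMeasure]
    exact Measure.AbsolutelyContinuous.rfl

end Metric

end Flow

/-! ## 4. Hard balls: unstable sets of the hard-sphere flow; u-Gibbs / u-regular laws on `𝕋^d` -/

section HardBalls

open Literature.Analysis.FluidPDE

variable {d : Type*} [Fintype d] {X : Type*} [MeasureSpace X] [PseudoMetricSpace X] {N : ℕ}
  {ε : ℝ} {G : Geometry d X}

/-- The **unstable set** `W^u(z)` of a configuration `z` under the hard-sphere flow `Φ`: the
configurations whose backward `Φ`-orbit converges exponentially to that of `z` (sup-product
metric on `(X × ℝ^d)^N`); for hard balls on `𝕋^d` and Liouville-a.e. `z` this is the unstable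
manifold of Sinai–Chernov 1987 (limits of images of convex local orthogonal manifolds).
Values off the good set of `Φ` are those of the junk values of `Φ.flow`. [cite: LedrappierYoung1985, (1.2) p. 512] -/
def _root_.Literature.Analysis.FluidPDE.HardSphereFlow.unstableSet (Φ : HardSphereFlow G ε N)
    (z : Config N d X) : Set (Config N d X) :=
  Billiards.unstableSet Φ.flow z

/-- The **local unstable set** `W^u_δ(z)` of size `δ` under the hard-sphere flow `Φ`: backward
orbits `δ`-close at all times and exponentially convergent. [cite: LedrappierYoung1985, (1.2) p. 512] -/
def _root_.Literature.Analysis.FluidPDE.HardSphereFlow.localUnstableSet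
    (Φ : HardSphereFlow G ε N) (δ : ℝ) (z : Config N d X) : Set (Config N d X) :=
  Billiards.localUnstableSet Φ.flow δ z

/-- Unfolding lemma. [folklore] -/
theorem _root_.Literature.Analysis.FluidPDE.HardSphereFlow.unstableSet_eq
    (Φ : HardSphereFlow G ε N) (z : Config N d X) :
    Φ.unstableSet z = Billiards.unstableSet Φ.flow z :=
  rfl

/-- Unfolding lemma. [folklore] -/
theorem _root_.Literature.Analysis.FluidPDE.HardSphereFlow.localUnstableSet_eq
    (Φ : HardSphereFlow G ε N) (δ : ℝ) (z : Config N d X) :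
    Φ.localUnstableSet δ z = Billiards.localUnstableSet Φ.flow δ z :=
  rfl

/-- A good configuration lies in each of its local unstable sets of nonnegative size. [folklore] -/
theorem _root_.Literature.Analysis.FluidPDE.HardSphereFlow.self_mem_localUnstableSet
    (Φ : HardSphereFlow G ε N) {δ : ℝ} (hδ : 0 ≤ δ) (z : Config N d X) :
    z ∈ Φ.localUnstableSet δ z :=
  Billiards.self_mem_localUnstableSet Φ.flow hδ z

/-- The **unstable dimension of `N` hard balls on `𝕋^d`**: `dN - d - 1`. Bookkeeping: phase
space `(𝕋^d × ℝ^d)^N` has dimension `2dN`; total momentum (`d`), energy (`1`), the centre of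
mass (`d`) and the flow direction (`1`) are neutral, and the remaining `2dN - 2d - 2`
directions split evenly into stable and unstable ones when the system is completely hyperbolic
(Sinai–Chernov 1987 for `N = 2`; Simányi–Szász 1999 for typical parameters, Simányi 2009/2013
for all — see the file of `Literature.MathematicalPhysics.KineticTheory.simanyi_hardBall_ergodic`).
Natural-number subtraction: the junk value `0` for `N ≤ 1` (no collisions, no expansion) is the
right one. [folklore] -/
def hardBallUnstableDim (d N : ℕ) : ℕ :=
  d * N - d - 1

/-- Two discs on `𝕋²` (equivalently the Sinai billiard with one circular scatterer) have
one-dimensional unstable manifolds: `2·2 - 2 - 1 = 1`. [folklore] -/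
theorem hardBallUnstableDim_two_two : hardBallUnstableDim 2 2 = 1 := rfl

/-- A law `μ` on the phase space of `N` hard balls of diameter `ε` on `𝕋^d` is **u-Gibbs** for the
hard-sphere flow `Φ` (Ledrappier–Young 1985 Def. 1.4.2 / Pesin–Sinai 1982, along the unstable
plaques of `Φ`): its conditional measures on every measurable partition subordinate to the local
unstable sets are absolutely continuous with respect to the `(dN-d-1)`-dimensional Hausdorff
measure, for every measurable size function. [cite: LedrappierYoung1985, Def. 1.4.2 p. 513] -/
def _root_.Literature.Analysis.FluidPDE.HardSphereFlow.IsUGibbs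
    (Φ : HardSphereFlow (Torus.geometry d) ε N) (μ : Measure (Config N d (UnitAddTorus d)))
    [IsFiniteMeasure μ] : Prop :=
  IsUGibbsOfDim Φ.flow (hardBallUnstableDim (Fintype.card d) N) μ

/-- A law `μ` on the phase space of `N` hard balls on `𝕋^d` is **u-regular** for the hard-sphere
flow `Φ` (partition-free form of u-Gibbs, the form used by route UGibbsRigidity): for every
measurable size function `δ > 0`, `μ` charges no measurable set that is
`μH[dN-d-1]`-null on `μ`-almost every local unstable set `W^u_{δ(z)}(z)`.
[cite: LedrappierYoung1985, Def. 1.4.2 p. 513] -/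
def _root_.Literature.Analysis.FluidPDE.HardSphereFlow.IsURegular
    (Φ : HardSphereFlow (Torus.geometry d) ε N) (μ : Measure (Config N d (UnitAddTorus d))) :
    Prop :=
  IsURegularOfDim Φ.flow (hardBallUnstableDim (Fintype.card d) N) μ

/-- u-Gibbs ⇒ u-regular for hard balls, given subordinate partitions (Sinai–Chernov's theorem
on the existence of local unstable manifolds supplies them Liouville-a.e.). [cite: LedrappierYoung1985, Def. 1.4.2 p. 513] -/
theorem _root_.Literature.Analysis.FluidPDE.HardSphereFlow.IsUGibbs.isURegular
    {Φ : HardSphereFlow (Torus.geometry d) ε N} {μ : Measure (Config N d (UnitAddTorus d))}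
    [IsFiniteMeasure μ] (h : Φ.IsUGibbs μ)
    (hex : ∀ δ : Config N d (UnitAddTorus d) → ℝ, Measurable δ → (∀ z, 0 < δ z) →
      ∃ ξ : MeasurablePartition (Config N d (UnitAddTorus d)),
        (unstablePlaques Φ.flow δ (hardBallUnstableDim (Fintype.card d) N)).IsSubordinate μ ξ) :
    Φ.IsURegular μ :=
  IsUGibbsOfDim.isURegularOfDim h hex

/-- **Mixtures of u-regular laws of the hard-ball flow are u-regular.** [folklore] -/
theorem _root_.Literature.Analysis.FluidPDE.HardSphereFlow.IsURegular.bind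
    {Φ : HardSphereFlow (Torus.geometry d) ε N} {ι : Type*} [MeasurableSpace ι] {P : Measure ι}
    {κ : Kernel ι (Config N d (UnitAddTorus d))} (h : ∀ᵐ i ∂P, Φ.IsURegular (κ i)) :
    Φ.IsURegular (P.bind κ) :=
  IsURegularOfDim.bind h

/-- The diagonal translation `translateAll a` is an isometry of the phase space `(𝕋^d × ℝ^d)^N`
(sup-product metric). [folklore] -/
theorem isometry_translateAll (a : UnitAddTorus d) :
    Isometry (Literature.MathematicalPhysics.KineticTheory.translateAll (N := N) a) :=
  Isometry.piMap (fun _ => Prod.map (IsometryEquiv.addRight a) id) fun _ =>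
    (IsometryEquiv.addRight a).isometry.prodMap isometry_id

/-- The diagonal translation by `a` as a self-isometry of phase space, with inverse the
translation by `-a`. [folklore] -/
def translateAllIsometryEquiv (N : ℕ) (a : UnitAddTorus d) :
    Config N d (UnitAddTorus d) ≃ᵢ Config N d (UnitAddTorus d) where
  toFun := Literature.MathematicalPhysics.KineticTheory.translateAll a
  invFun := Literature.MathematicalPhysics.KineticTheory.translateAll (-a)
  left_inv z := by
    rw [← Literature.MathematicalPhysics.KineticTheory.translateAll_add, neg_add_cancel,
      Literature.MathematicalPhysics.KineticTheory.translateAll_zero]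
  right_inv z := by
    rw [← Literature.MathematicalPhysics.KineticTheory.translateAll_add, add_neg_cancel,
      Literature.MathematicalPhysics.KineticTheory.translateAll_zero]
  isometry_toFun := isometry_translateAll a

/-- Unfolding lemma for `translateAllIsometryEquiv`. [folklore] -/
@[simp]
theorem translateAllIsometryEquiv_apply (N : ℕ) (a : UnitAddTorus d)
    (z : Config N d (UnitAddTorus d)) :
    translateAllIsometryEquiv N a z = Literature.MathematicalPhysics.KineticTheory.translateAll a z :=
  rfl

/-- **Behaviour under translations**: if the hard-sphere flow is translation covariant
(`Φ_t (z + a) = Φ_t z + a`, as every flow constructed from the equations of motion is on its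
good set), the translate of a u-regular law is u-regular; in particular u-regularity is a
property of translation-invariant laws compatible with averaging over translations. [folklore] -/
theorem _root_.Literature.Analysis.FluidPDE.HardSphereFlow.IsURegular.map_translateAll
    {Φ : HardSphereFlow (Torus.geometry d) ε N} {μ : Measure (Config N d (UnitAddTorus d))}
    (h : Φ.IsURegular μ) (a : UnitAddTorus d)
    (hcomm : ∀ t z, Φ.flow t (Literature.MathematicalPhysics.KineticTheory.translateAll a z) =
      Literature.MathematicalPhysics.KineticTheory.translateAll a (Φ.flow t z)) :
    Φ.IsURegular (μ.map (Literature.MathematicalPhysics.KineticTheory.translateAll a)) :=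
  IsURegularOfDim.map_isometryEquiv h (translateAllIsometryEquiv N a) hcomm

end HardBalls


end Literature.Dynamics.Billiards
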